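import Summits.NavierStokesRegularity.NavierStokesRegularity.Theorems.AdaptedFrequencyTangentFlowTransferZoom
import Literature.Analysis.FluidPDE.DirectionDissipation
import Literature.Analysis.FluidPDE.LocalTypeIScaling
import HarnessLib

/-!
# Parabolic zoom covariance of the adapted enstrophy, the adapted frequency and the solution
# clauses (route `AdaptedFrequency`, item `TangentFlowTransfer`, stmt-NavierStokesRegularity-10494)

Helper file (all results proved), companion of `AdaptedFrequencyTangentFlowTransferZoom`. For the
zoom `u_c = c • stPull (c²) c T x₀ u`, `G_c = c³ • stPull (c²) c T x₀ G` about `(T, x₀)` on `ℝ³`: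

* `adaptedEnstrophy_zoom`: `H_c(s) = c⁴ H(T + c² s)` (`ω_c = c² ω ∘ Φ`, weight `c³`, Jacobian
  `c⁻³`; no integrability needed, both sides being junk `0` together);
* `deriv_adaptedEnstrophy_zoom`, `adaptedFrequency_zoom`: `H_c′(s) = c⁶ H′(T + c² s)` and the
  adapted frequency is scale invariant, `Λ_c(s) = Λ(T + c² s)` — including every junk case of
  Mathlib's `deriv` and of the division by `H = 0` —, hence `tendsto_adaptedFrequency_zoom`
  (`Λ(t) → Λ₀` as `t ↑ T` gives `Λ_c(s) → Λ₀` as `s ↑ 0`) and `tendsto_adaptedFrequency_zoom_seq`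
  (along `c_k → 0⁺`, `Λ_{c_k}(τ) → Λ₀` for every fixed `τ < 0`: the limit frequency is constant);
* `isClassicalNSSolutionOn_zoom_Ico`, `typeI_bound_zoom`, `exists_window_of_isTypeIBlowup`,
  `singular_zoom`: classical solutions on `[t₀, T)` zoom to classical solutions on
  `[(t₀ − T)/c², 0)`, the Type-I bound `‖u‖ ≤ C/√(T − t)` becomes `‖u_c‖ ≤ C/√(−s)`, and backward
  singularity of `(T, x₀)` becomes backward singularity of `(0, 0)`.

References: J. Leray, Acta Math. 63 (1934), §20; G. Koch, N. Nadirashvili, G. Seregin, V. Šverák,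
Acta Math. 203 (2009) = arXiv:0709.3599, §6 (6.2); C.-C. Poon, Comm. PDE 21 (1996) (frequency).
-/

noncomputable section

open MeasureTheory Set Function Filter TopologicalSpace Metric
open scoped Topology NNReal ENNReal InnerProductSpace Laplacian

namespace Summit.NavierStokesRegularity.NavierStokesRegularity.Theorems

open Literature.Analysis Literature.Analysis.FluidPDE

/-! ### Adapted enstrophy and frequency under the zoom (`ℝ³`) -/

section Frequency

variable {u : ℝ → EuclideanSpace ℝ (Fin 3) → EuclideanSpace ℝ (Fin 3)}
  {G : ℝ → EuclideanSpace ℝ (Fin 3) → ℝ}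

/-- **Adapted enstrophy under the zoom**: `H_c(s) = c⁴ H(T + c² s)`, where
`H = adaptedEnstrophy u G`, `H_c = adaptedEnstrophy u_c G_c`, `u_c = c u ∘ Φ`, `G_c = c³ G ∘ Φ`
(`curl u_c = c² (curl u) ∘ Φ`, weight `c³`, Jacobian `c⁻³`; no integrability needed, both sides
being junk `0` together). [folklore] -/
theorem adaptedEnstrophy_zoom (u : ℝ → EuclideanSpace ℝ (Fin 3) → EuclideanSpace ℝ (Fin 3))
    (G : ℝ → EuclideanSpace ℝ (Fin 3) → ℝ) (T : ℝ) (x₀ : EuclideanSpace ℝ (Fin 3)) {c : ℝ}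
    (hc : 0 < c) (s : ℝ) :
    adaptedEnstrophy (c • stPull (c ^ 2) c T x₀ u) ((c ^ 3) • stPull (c ^ 2) c T x₀ G) s =
      c ^ 4 * adaptedEnstrophy u G (T + c ^ 2 * s) := by
  rw [adaptedEnstrophy_apply, adaptedEnstrophy_apply]
  have h1 : (fun y => ‖curl ((c • stPull (c ^ 2) c T x₀ u) s) y‖ ^ 2 *
      ((c ^ 3) • stPull (c ^ 2) c T x₀ G) s y) =
      fun y => c ^ 7 * (fun x => ‖curl (u (T + c ^ 2 * s)) x‖ ^ 2 * G (T + c ^ 2 * s) x)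
        (x₀ + c • y) := by
    funext y
    rw [curl_smul_stPull, smul_stPull_kernel_apply, norm_smul, Real.norm_eq_abs,
      abs_of_pos (mul_pos hc hc)]
    ring
  rw [h1, integral_const_mul, integral_comp_space_affine hc x₀
      (fun x => ‖curl (u (T + c ^ 2 * s)) x‖ ^ 2 * G (T + c ^ 2 * s) x),
    finrank_euclideanSpace_fin, smul_eq_mul, ← mul_assoc]
  congr 1
  field_simp

/-- The same, as an identity of functions. [folklore] -/
theorem adaptedEnstrophy_zoom_eq (u : ℝ → EuclideanSpace ℝ (Fin 3) → EuclideanSpace ℝ (Fin 3))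
    (G : ℝ → EuclideanSpace ℝ (Fin 3) → ℝ) (T : ℝ) (x₀ : EuclideanSpace ℝ (Fin 3)) {c : ℝ}
    (hc : 0 < c) :
    adaptedEnstrophy (c • stPull (c ^ 2) c T x₀ u) ((c ^ 3) • stPull (c ^ 2) c T x₀ G) =
      fun s => c ^ 4 * adaptedEnstrophy u G (T + c ^ 2 * s) :=
  funext fun s => adaptedEnstrophy_zoom u G T x₀ hc s

/-- The derivative of the zoomed adapted enstrophy: `H_c′(s) = c⁶ H′(T + c² s)` (Mathlib `deriv`,
no differentiability needed: both sides are junk `0` together). [folklore] -/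
theorem deriv_adaptedEnstrophy_zoom (u : ℝ → EuclideanSpace ℝ (Fin 3) → EuclideanSpace ℝ (Fin 3))
    (G : ℝ → EuclideanSpace ℝ (Fin 3) → ℝ) (T : ℝ) (x₀ : EuclideanSpace ℝ (Fin 3)) {c : ℝ}
    (hc : 0 < c) (s : ℝ) :
    deriv (adaptedEnstrophy (c • stPull (c ^ 2) c T x₀ u) ((c ^ 3) • stPull (c ^ 2) c T x₀ G)) s =
      c ^ 6 * deriv (adaptedEnstrophy u G) (T + c ^ 2 * s) := by
  rw [adaptedEnstrophy_zoom_eq u G T x₀ hc, deriv_const_mul_field]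
  set H := adaptedEnstrophy u G with hH
  have h1 : (fun s => H (T + c ^ 2 * s)) = ((fun r => H (T + r)) <| c ^ 2 * ·) := rfl
  rw [h1, deriv_comp_mul_left (c ^ 2) (fun r => H (T + r)) s, smul_eq_mul]
  rw [deriv_comp_const_add (f := H) (a := T) (x := c ^ 2 * s)]
  ring

/-- **Scale invariance of the adapted frequency**: `Λ_c(s) = Λ(T + c² s)` for every `s`, where
`Λ = adaptedFrequency u G T` and `Λ_c = adaptedFrequency u_c G_c 0` — including the junk cases
(`deriv` of a non-differentiable `H`, division by `H = 0`). [folklore] -/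
theorem adaptedFrequency_zoom (u : ℝ → EuclideanSpace ℝ (Fin 3) → EuclideanSpace ℝ (Fin 3))
    (G : ℝ → EuclideanSpace ℝ (Fin 3) → ℝ) (T : ℝ) (x₀ : EuclideanSpace ℝ (Fin 3)) {c : ℝ}
    (hc : 0 < c) (s : ℝ) :
    adaptedFrequency (c • stPull (c ^ 2) c T x₀ u) ((c ^ 3) • stPull (c ^ 2) c T x₀ G) 0 s =
      adaptedFrequency u G T (T + c ^ 2 * s) := by
  rw [adaptedFrequency_apply, adaptedFrequency_apply, deriv_adaptedEnstrophy_zoom u G T x₀ hc s,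
    adaptedEnstrophy_zoom u G T x₀ hc s]
  set H := adaptedEnstrophy u G (T + c ^ 2 * s)
  set H' := deriv (adaptedEnstrophy u G) (T + c ^ 2 * s)
  have hc4 : (c ^ 4 : ℝ) ≠ 0 := by positivity
  rw [show (0 - s) * (c ^ 6 * H') = ((T - (T + c ^ 2 * s)) * H') * c ^ 4 by ring,
    show c ^ 4 * H = H * c ^ 4 by ring, mul_div_mul_right _ _ hc4]

/-- **The limit of the adapted frequency transfers to the zoom**: if `Λ(t) → Λ₀` as `t ↑ T` then
`Λ_c(s) → Λ₀` as `s ↑ 0`. [folklore] -/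
theorem tendsto_adaptedFrequency_zoom {T : ℝ} {x₀ : EuclideanSpace ℝ (Fin 3)} {Λ₀ : ℝ}
    (h : Tendsto (adaptedFrequency u G T) (𝓝[<] T) (𝓝 Λ₀)) {c : ℝ} (hc : 0 < c) :
    Tendsto (adaptedFrequency (c • stPull (c ^ 2) c T x₀ u) ((c ^ 3) • stPull (c ^ 2) c T x₀ G) 0)
      (𝓝[<] 0) (𝓝 Λ₀) := by
  have h1 : adaptedFrequency (c • stPull (c ^ 2) c T x₀ u) ((c ^ 3) • stPull (c ^ 2) c T x₀ G) 0 =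
      adaptedFrequency u G T ∘ fun s => T + c ^ 2 * s :=
    funext fun s => adaptedFrequency_zoom u G T x₀ hc s
  rw [h1]
  exact h.comp (tendsto_zoomTime_nhdsLT hc.ne' T)

/-- For every `τ < 0` the zoomed frequencies along a blow-up sequence `c_k → 0⁺` converge to the
limit frequency: `Λ_{c_k}(τ) = Λ(T + c_k² τ) → Λ₀`. [folklore] -/
theorem tendsto_adaptedFrequency_zoom_seq {T : ℝ} {x₀ : EuclideanSpace ℝ (Fin 3)} {Λ₀ : ℝ}
    (h : Tendsto (adaptedFrequency u G T) (𝓝[<] T) (𝓝 Λ₀)) {c : ℕ → ℝ} (hc : ∀ k, 0 < c k)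
    (hc0 : Tendsto c atTop (𝓝 0)) {τ : ℝ} (hτ : τ < 0) :
    Tendsto (fun k => adaptedFrequency (c k • stPull (c k ^ 2) (c k) T x₀ u)
      ((c k ^ 3) • stPull (c k ^ 2) (c k) T x₀ G) 0 τ) atTop (𝓝 Λ₀) := by
  have h1 : (fun k => adaptedFrequency (c k • stPull (c k ^ 2) (c k) T x₀ u)
      ((c k ^ 3) • stPull (c k ^ 2) (c k) T x₀ G) 0 τ) = adaptedFrequency u G T ∘ fun k => T + c k ^ 2 * τ :=
    funext fun k => adaptedFrequency_zoom u G T x₀ (hc k) τ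
  rw [h1]
  refine h.comp (tendsto_nhdsWithin_of_tendsto_nhds_of_eventually_within _ ?_ ?_)
  · have : Tendsto (fun k => T + c k ^ 2 * τ) atTop (𝓝 (T + 0 ^ 2 * τ)) :=
      tendsto_const_nhds.add ((hc0.pow 2).mul tendsto_const_nhds)
    simpa using this
  · refine Eventually.of_forall fun k => ?_
    have : 0 < c k ^ 2 := pow_pos (hc k) 2
    simp only [mem_Iio]
    nlinarith

end Frequency

/-! ### The solution clauses under the zoom -/

section Solution

variable {u : ℝ → EuclideanSpace ℝ (Fin 3) → EuclideanSpace ℝ (Fin 3)}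
  {p : ℝ → EuclideanSpace ℝ (Fin 3) → ℝ}

/-- Classical solutions on `[t₀, T)` zoom to classical solutions on `[(t₀ − T)/c², 0)` (KNSS 2009,
§6 (6.2); the tree's `IsClassicalNSSolutionOn.nsRescale_translate_zero`). [cite: KochNadirashviliSereginSverak2009, §6 (6.2)] -/
theorem isClassicalNSSolutionOn_zoom_Ico {ν t₀ T : ℝ} (h : IsClassicalNSSolutionOn (Ico t₀ T) ν 0 u p)
    {c : ℝ} (hc : 0 < c) (x₀ : EuclideanSpace ℝ (Fin 3)) :
    IsClassicalNSSolutionOn (Ico ((t₀ - T) / c ^ 2) 0) ν 0 (c • stPull (c ^ 2) c T x₀ u)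
      (c ^ 2 • stPull (c ^ 2) c T x₀ p) := by
  have key := h.nsRescale_translate_zero hc T x₀
  rwa [preimage_zoomTime_Ico hc.ne'] at key

/-- **The Type-I bound is scale invariant**: `‖u(t, x)‖ ≤ C/√(T − t)` on `(t₁, T)` gives
`‖u_c(s, y)‖ ≤ C/√(−s)` on `((t₁ − T)/c², 0)`. [folklore] -/
theorem typeI_bound_zoom {T t₁ C : ℝ} (h : ∀ t ∈ Ioo t₁ T, ∀ x, ‖u t x‖ ≤ C / Real.sqrt (T - t))
    {c : ℝ} (hc : 0 < c) (x₀ : EuclideanSpace ℝ (Fin 3)) :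
    ∀ s ∈ Ioo ((t₁ - T) / c ^ 2) 0, ∀ y, ‖(c • stPull (c ^ 2) c T x₀ u) s y‖ ≤ C / Real.sqrt (-s) := by
  intro s hs y
  have ht : s ∈ (fun r : ℝ => T + c ^ 2 * r) ⁻¹' Ioo t₁ T := by
    rw [preimage_zoomTime_Ioo hc.ne']; exact hs
  have hb := h _ ht (x₀ + c • y)
  have hs0 : 0 < -s := by linarith [hs.2]
  have hsqrt : Real.sqrt (T - (T + c ^ 2 * s)) = c * Real.sqrt (-s) := by
    rw [sub_zoomTime, zero_sub, Real.sqrt_mul' _ hs0.le, Real.sqrt_sq hc.le]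
  rw [hsqrt] at hb
  simp only [Pi.smul_apply, stPull_apply, norm_smul, Real.norm_eq_abs, abs_of_pos hc]
  have hcs : 0 < c * Real.sqrt (-s) := mul_pos hc (Real.sqrt_pos.2 hs0)
  calc c * ‖u (T + c ^ 2 * s) (x₀ + c • y)‖ ≤ c * (C / (c * Real.sqrt (-s))) :=
        mul_le_mul_of_nonneg_left hb hc.le
    _ = C / Real.sqrt (-s) := by field_simp

/-- The `IsTypeIBlowup` rate (eventual form) delivers a window `(t₁, T)` on which the explicit
Type-I bound holds. [folklore] -/
theorem exists_window_of_isTypeIBlowup {T : ℝ} (h : IsTypeIBlowup u T) :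
    ∃ C t₁ : ℝ, t₁ < T ∧ ∀ t ∈ Ioo t₁ T, ∀ x, ‖u t x‖ ≤ C / Real.sqrt (T - t) := by
  obtain ⟨C, hC⟩ := h
  obtain ⟨t₁, ht₁, hsub⟩ := (mem_nhdsLT_iff_exists_Ioo_subset).1 hC
  exact ⟨C, t₁, ht₁, fun t ht x => hsub ht x⟩

/-- **Backward singularity is scale invariant**: if `(T, x₀)` is a backward-singular point of `u`
(`u` essentially unbounded on every `Q_r(T, x₀)`), then `(0, 0)` is a backward-singular point of
the zoom `u_c` (`‖u_c‖_{L^∞(Q_r(0,0))} = c ‖u‖_{L^∞(Q_{c r}(T, x₀))}`, the tree's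
`eLpNorm_top_nsZoom`). [folklore] -/
theorem singular_zoom {T : ℝ} {x₀ : EuclideanSpace ℝ (Fin 3)}
    (h : ∀ r : ℝ, 0 < r → eLpNorm (uncurry u) ⊤
      (volume.restrict (parabolicCylinder r ((T, x₀) : ℝ × EuclideanSpace ℝ (Fin 3)))) = ⊤)
    {c : ℝ} (hc : 0 < c) :
    ∀ r : ℝ, 0 < r → eLpNorm (uncurry (c • stPull (c ^ 2) c T x₀ u)) ⊤
      (volume.restrict (parabolicCylinder r ((0, 0) : ℝ × EuclideanSpace ℝ (Fin 3)))) = ⊤ := by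
  intro r hr
  rw [eLpNorm_top_nsZoom hc T x₀ r (0, 0) u]
  have h0 : stAffine (c ^ 2) c T x₀ ((0, 0) : ℝ × EuclideanSpace ℝ (Fin 3)) = (T, x₀) := by
    simp [stAffine_apply]
  rw [h0, h (c * r) (mul_pos hc hr), ENNReal.mul_top (by simpa using hc)]

end Solution

end Summit.NavierStokesRegularity.NavierStokesRegularity.Theorems

end
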